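import Literature.Analysis.FluidPDE.TorusWordEnergy
import Literature.Analysis.FluidPDE.TorusWordL2Bounds
import Literature.Analysis.FluidPDE.TorusWordSpaceTime
import Literature.Analysis.FluidPDE.CompressibleEulerLinearizedDerivative
import HarnessLib

/-!
# Stub `stub_liftBounds` of the line `SketchIdeator2` (card `separatrix-flux-pinning`), part B:
# word-level `L²` and sup estimates on `T³`
# (crux stmt-AnomalousDissipation-14249, `MarginalStabilityChain.ChainRealisation`)

Space-only estimates for derivative words `∂^w` of smooth fields on `T³` used by the stub
`stub_liftBounds` (the energy method at arbitrary order, Foias–Manley–Rosa–Temam 2001,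
Ch. II §A.5; Majda 1984, Ch. 2 Prop. 2.1):

* `liftB_integral_norm_sq_wordDeriv_le_wordEnergy`, `liftB_exists_norm_sq_wordDeriv_le` — the
  tree's word energies and the sup bound `‖∂^w f‖²_∞ ≤ K E_{|w|+2}(f)` for `List` words;
* `liftB_integral_norm_sq_wordDeriv_laplacian_le` — `∫‖∂^w Δf‖² ≤ 9 E_{|w|+2}(f)`;
* `liftB_norm_wordDeriv_convect_le` — the pointwise Leibniz bound for `∂^w((a·∇)b)`, and its
  `L²` consequence `liftB_exists_convect_word_sq`:
  `∫‖∂^w((a·∇)b)‖² ≤ K 4^{|w|} E_{|w|+2}(a) E_{|w|+2}(b)` (sup × `L²`);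
* `liftB_integral_norm_sq_le_of_eq_sub_gradient` — the pressure-free energy inequality: if
  `A = B − ∇g` with `A` smooth and solenoidal then `‖A‖₂ ≤ ‖B‖₂`.

References: C. Foias, O. Manley, R. Rosa, R. Temam, *Navier–Stokes Equations and Turbulence*,
CUP 2001, Ch. II App. A §A.5; A. Majda, *Compressible Fluid Flow and Systems of Conservation
Laws in Several Space Variables*, Springer 1984, Ch. 2 §2.1.
-/

-- `Summit.<Summit>.<Problem>` is the tree's mandated summit-side namespace (CONVENTIONS §2); for this
-- single-conjunct summit the two coincide, so the duplicate is deliberate.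
set_option linter.dupNamespace false

noncomputable section

open MeasureTheory Set Filter Topology Function
open scoped InnerProductSpace
open Literature.Analysis.FunctionSpaces Literature.Analysis.FunctionSpaces.Torus
open Literature.Analysis.FluidPDE.Torus

namespace Summit.AnomalousDissipation.AnomalousDissipation.Theorems.ChainRealisation.SeparatrixFluxPinning

variable {F : Type*} [NormedAddCommGroup F] [NormedSpace ℝ F]
variable {F' : Type*} [NormedAddCommGroup F'] [InnerProductSpace ℝ F']

/-! ## Word energies for `List` words -/

omit [NormedSpace ℝ F] in
/-- A `List` sum of reals as a sum over positions. -/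
theorem liftB_list_sum_eq_sum_fin {ι : Type*} (l : List ι) (g : ι → ℝ) :
    (l.map g).sum = ∑ m : Fin l.length, g (l.get m) := by
  rw [← List.sum_ofFn]
  congr 1
  exact (List.ofFn_getElem_eq_map l g).symm

/-- A single word is dominated by the word energy of its length (`List` form). -/
theorem liftB_integral_norm_sq_wordDeriv_le_wordEnergy (w : List (Fin 3)) (f : UnitAddTorus (Fin 3) → F') :
    ∫ x, ‖wordDeriv w f x‖ ^ 2 ≤ wordEnergy w.length f := by
  have h := integral_norm_sq_wordDeriv_le_wordEnergy (d := Fin 3) w.get f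
  rwa [List.ofFn_get] at h

/-- **`‖∂^w f‖²_∞ ≤ K E_{|w|+2}(f)` on `T³`** for every `List` word `w` (the tree's Sobolev
embedding `Torus.exists_norm_sq_wordDeriv_le_sobolevEnergy`). -/
theorem liftB_exists_norm_sq_wordDeriv_le (F' : Type*) [NormedAddCommGroup F']
    [InnerProductSpace ℝ F'] [FiniteDimensional ℝ F'] :
    ∃ K : ℝ, 0 < K ∧ ∀ (f : UnitAddTorus (Fin 3) → F'), IsSmooth f → ∀ (w : List (Fin 3)) (x : UnitAddTorus (Fin 3)),
      ‖wordDeriv w f x‖ ^ 2 ≤ K * sobolevEnergy (w.length + 2) f := by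
  obtain ⟨K, hK, h⟩ := exists_norm_sq_wordDeriv_le_sobolevEnergy F'
  refine ⟨K, hK, fun f hf w x => ?_⟩
  have h1 := h f hf (n := w.length) (m := w.length + 2) le_rfl w.get x
  rwa [List.ofFn_get] at h1

/-- `(∂^w u)(x)ᵢ = ∂^w (uᵢ)(x)` for smooth vector fields. -/
theorem liftB_wordDeriv_apply_coord {u : UnitAddTorus (Fin 3) → EuclideanSpace ℝ (Fin 3)} (hu : IsSmooth u) (i : Fin 3) :
    ∀ (w : List (Fin 3)) (x : UnitAddTorus (Fin 3)), wordDeriv w u x i = wordDeriv w (fun y => u y i) x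
  | [], _ => rfl
  | j :: w, x => by
      rw [wordDeriv_cons, wordDeriv_cons,
        ← partialDeriv_apply_coord ((isSmooth_wordDeriv hu w).isContDiff (by simp)) j x i]
      congr 1
      funext y
      exact liftB_wordDeriv_apply_coord hu i w y

/-- `∂^w (∑ᵢ fᵢ) = ∑ᵢ ∂^w fᵢ` for smooth `fᵢ` (space-only twin for part B). -/
theorem liftB_wordDeriv_fun_sum {ι : Type*} (s : Finset ι) {f : ι → UnitAddTorus (Fin 3) → F}
    (hf : ∀ i ∈ s, IsSmooth (f i)) :
    ∀ w : List (Fin 3), wordDeriv w (fun y => ∑ i ∈ s, f i y) = fun y => ∑ i ∈ s, wordDeriv w (f i) y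
  | [] => rfl
  | j :: w => by
      rw [wordDeriv_cons, liftB_wordDeriv_fun_sum s hf w]
      funext x
      rw [partialDeriv_finset_sum s
        (fun i hi => ((isSmooth_wordDeriv (hf i hi) w).isContDiff (by simp))) j x]
      rfl

/-! ## The Laplacian costs two letters -/

/-- `∂^w Δf = ∑ᵢ ∂^{w ++ [i, i]} f` for smooth `f`. -/
theorem liftB_wordDeriv_laplacian {f : UnitAddTorus (Fin 3) → F} (hf : IsSmooth f) (w : List (Fin 3)) :
    wordDeriv w (laplacian f) = fun x => ∑ i, wordDeriv (w ++ [i, i]) f x := by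
  have e : laplacian f = fun x => ∑ i, partialDeriv i (partialDeriv i f) x :=
    funext (laplacian_eq_sum_partialDeriv_partialDeriv hf)
  rw [e, liftB_wordDeriv_fun_sum Finset.univ (fun i _ => (hf.partialDeriv i).partialDeriv i) w]
  funext x
  refine Finset.sum_congr rfl fun i _ => ?_
  rw [wordDeriv_append]
  rfl

/-- **`∫‖∂^w Δf‖² ≤ 9 E_{|w|+2}(f)`** on `T³`. -/
theorem liftB_integral_norm_sq_wordDeriv_laplacian_le {f : UnitAddTorus (Fin 3) → F'} (hf : IsSmooth f)
    (w : List (Fin 3)) :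
    ∫ x, ‖wordDeriv w (laplacian f) x‖ ^ 2 ≤ 9 * wordEnergy (w.length + 2) f := by
  rw [liftB_wordDeriv_laplacian hf w]
  calc ∫ x, ‖∑ i, wordDeriv (w ++ [i, i]) f x‖ ^ 2
      ≤ (Fintype.card (Fin 3)) * ∑ i, ∫ x, ‖wordDeriv (w ++ [i, i]) f x‖ ^ 2 :=
        integral_norm_sq_sum_le fun i => (isSmooth_wordDeriv hf _).continuous
    _ ≤ 3 * ∑ _i : Fin 3, wordEnergy (w.length + 2) f := by
        rw [Fintype.card_fin]
        push_cast
        refine mul_le_mul_of_nonneg_left (Finset.sum_le_sum fun i _ => ?_) (by norm_num)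
        have h := liftB_integral_norm_sq_wordDeriv_le_wordEnergy (w ++ [i, i]) f
        simpa using h
    _ = 9 * wordEnergy (w.length + 2) f := by
        simp only [Finset.sum_const, Finset.card_univ, Fintype.card_fin, nsmul_eq_mul]
        ring

/-! ## The convective term along a word: pointwise and `L²` -/

/-- **Pointwise Leibniz bound for `∂^w((a·∇)b)`**:
`‖∂^w((a·∇)b)(x)‖ ≤ ∑ₖ ∑_{(α,β) ∈ splits w} |∂^α aₖ(x)| ‖∂^{β ++ [k]} b(x)‖`. -/
theorem liftB_norm_wordDeriv_convect_le {a : UnitAddTorus (Fin 3) → EuclideanSpace ℝ (Fin 3)} {b : UnitAddTorus (Fin 3) → F} (ha : IsSmooth a)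
    (hb : IsSmooth b) (w : List (Fin 3)) (x : UnitAddTorus (Fin 3)) :
    ‖wordDeriv w (convect a b) x‖ ≤ ∑ k : Fin 3, ∑ m : Fin (splits w).length,
      |wordDeriv ((splits w).get m).1 (fun y => a y k) x| *
        ‖wordDeriv (((splits w).get m).2 ++ [k]) b x‖ := by
  have e : convect a b = fun y => ∑ k, (a y) k • partialDeriv k b y :=
    funext fun y => fderiv_apply_eq_sum_partialDeriv (hb.isContDiff (by simp)) y (a y)
  rw [e, liftB_wordDeriv_fun_sum Finset.univ (fun k _ => (ha.apply k).smul' (hb.partialDeriv k)) w]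
  refine (norm_sum_le _ _).trans (Finset.sum_le_sum fun k _ => ?_)
  refine (norm_wordDeriv_smul_le (ha.apply k) (hb.partialDeriv k) w x).trans (le_of_eq ?_)
  rw [liftB_list_sum_eq_sum_fin]
  refine Finset.sum_congr rfl fun m _ => ?_
  rw [wordDeriv_concat]

/-- `(∑ₖ ∑ₘ c)² ≤ 3 n ∑ₖ ∑ₘ c²` for a double sum over `Fin 3 × Fin n`. -/
theorem liftB_sq_sum_sum_le {n : ℕ} (c : Fin 3 → Fin n → ℝ) :
    (∑ k, ∑ m, c k m) ^ 2 ≤ 3 * n * ∑ k, ∑ m, c k m ^ 2 := by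
  have h1 : (∑ k, ∑ m, c k m) ^ 2 ≤ 3 * ∑ k, (∑ m, c k m) ^ 2 := by
    have h := sq_sum_le_card_mul_sum_sq (s := (Finset.univ : Finset (Fin 3))) (f := fun k => ∑ m, c k m)
    simpa using h
  have h2 : ∀ k, (∑ m, c k m) ^ 2 ≤ n * ∑ m, c k m ^ 2 := fun k => by
    have h := sq_sum_le_card_mul_sum_sq (s := (Finset.univ : Finset (Fin n))) (f := fun m => c k m)
    simpa using h
  calc (∑ k, ∑ m, c k m) ^ 2 ≤ 3 * ∑ k, (∑ m, c k m) ^ 2 := h1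
    _ ≤ 3 * ∑ k, (n * ∑ m, c k m ^ 2) := by gcongr with k; exact h2 k
    _ = 3 * n * ∑ k, ∑ m, c k m ^ 2 := by rw [← Finset.mul_sum]; ring

/-- **The `L²` word estimate of the convective term** (sup × `L²`): there is `K > 0` such that for
all smooth `a : T³ → ℝ³`, `b : T³ → F'` and every word `w`,
`∫‖∂^w((a·∇)b)‖² ≤ K 4^{|w|} E_{|w|+2}(a) E_{|w|+2}(b)`. -/
theorem liftB_exists_convect_word_sq (F' : Type*) [NormedAddCommGroup F']
    [InnerProductSpace ℝ F'] :
    ∃ K : ℝ, 0 < K ∧ ∀ (a : UnitAddTorus (Fin 3) → EuclideanSpace ℝ (Fin 3)) (b : UnitAddTorus (Fin 3) → F'), IsSmooth a → IsSmooth b →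
      ∀ (w : List (Fin 3)), ∫ x, ‖wordDeriv w (convect a b) x‖ ^ 2 ≤
        K * 4 ^ w.length * sobolevEnergy (w.length + 2) a * sobolevEnergy (w.length + 2) b := by
  obtain ⟨K, hK, hsup⟩ := liftB_exists_norm_sq_wordDeriv_le (EuclideanSpace ℝ (Fin 3))
  refine ⟨9 * K, by positivity, fun a b ha hb w => ?_⟩
  set n := (splits w).length with hn_def
  have hn : (n : ℝ) = 2 ^ w.length := by
    rw [hn_def, length_splits]
    push_cast
    rfl
  set Ea := sobolevEnergy (w.length + 2) a with hEa
  set Eb := sobolevEnergy (w.length + 2) b with hEb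
  have hEa0 : 0 ≤ Ea := sobolevEnergy_nonneg _ _
  have hEb0 : 0 ≤ Eb := sobolevEnergy_nonneg _ _
  -- the `b`-words appearing in the expansion
  set c : UnitAddTorus (Fin 3) → Fin 3 → Fin n → ℝ := fun x k m => ‖wordDeriv (((splits w).get m).2 ++ [k]) b x‖
    with hc
  -- pointwise bound
  have hpt : ∀ x, ‖wordDeriv w (convect a b) x‖ ^ 2 ≤
      K * Ea * (3 * n * ∑ k : Fin 3, ∑ m : Fin n, c x k m ^ 2) := by
    intro x
    have hA : ∀ (k : Fin 3) (m : Fin n),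
        |wordDeriv ((splits w).get m).1 (fun y => a y k) x| ≤ Real.sqrt (K * Ea) := by
      intro k m
      rw [← liftB_wordDeriv_apply_coord ha k]
      refine Real.le_sqrt_of_sq_le ?_
      have hle := (mem_splits_length_le (List.get_mem (splits w) m)).1
      calc |wordDeriv ((splits w).get m).1 a x k| ^ 2
          ≤ ‖wordDeriv ((splits w).get m).1 a x‖ ^ 2 := by
            refine pow_le_pow_left₀ (abs_nonneg _) ?_ 2
            rw [← Real.norm_eq_abs]
            exact PiLp.norm_apply_le _ k
        _ ≤ K * sobolevEnergy (((splits w).get m).1.length + 2) a := hsup a ha _ x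
        _ ≤ K * Ea := mul_le_mul_of_nonneg_left (sobolevEnergy_mono (by omega) a) hK.le
    have h2 : ‖wordDeriv w (convect a b) x‖ ≤ Real.sqrt (K * Ea) * ∑ k : Fin 3, ∑ m : Fin n, c x k m := by
      refine (liftB_norm_wordDeriv_convect_le ha hb w x).trans ?_
      rw [Finset.mul_sum]
      refine Finset.sum_le_sum fun k _ => ?_
      rw [Finset.mul_sum]
      refine Finset.sum_le_sum fun m _ => ?_
      exact mul_le_mul_of_nonneg_right (hA k m) (norm_nonneg _)
    have hS0 : 0 ≤ ∑ k : Fin 3, ∑ m : Fin n, c x k m :=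
      Finset.sum_nonneg fun k _ => Finset.sum_nonneg fun m _ => norm_nonneg _
    calc ‖wordDeriv w (convect a b) x‖ ^ 2
        ≤ (Real.sqrt (K * Ea) * ∑ k : Fin 3, ∑ m : Fin n, c x k m) ^ 2 :=
          pow_le_pow_left₀ (norm_nonneg _) h2 2
      _ = K * Ea * (∑ k : Fin 3, ∑ m : Fin n, c x k m) ^ 2 := by
          rw [mul_pow, Real.sq_sqrt (by positivity)]
      _ ≤ K * Ea * (3 * n * ∑ k : Fin 3, ∑ m : Fin n, c x k m ^ 2) :=
          mul_le_mul_of_nonneg_left (liftB_sq_sum_sum_le (c x)) (by positivity)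
  -- integrate
  have ci : ∀ {g : UnitAddTorus (Fin 3) → ℝ}, Continuous g → Integrable g volume := fun hg =>
    hg.integrable_of_hasCompactSupport (HasCompactSupport.of_compactSpace _)
  have hcont_c : ∀ k m, Continuous fun x => c x k m ^ 2 := fun k m =>
    ((isSmooth_wordDeriv hb _).continuous.norm).pow 2
  have hint_sum : Integrable (fun x => ∑ k : Fin 3, ∑ m : Fin n, c x k m ^ 2) volume :=
    integrable_finsetSum _ fun k _ => integrable_finsetSum _ fun m _ => ci (hcont_c k m)
  have hword : ∀ k m, ∫ x, c x k m ^ 2 ≤ Eb := by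
    intro k m
    have hle := (mem_splits_length_le (List.get_mem (splits w) m)).2
    calc ∫ x, c x k m ^ 2 ≤ wordEnergy ((((splits w).get m).2 ++ [k]).length) b :=
          liftB_integral_norm_sq_wordDeriv_le_wordEnergy _ b
      _ ≤ Eb := wordEnergy_le_sobolevEnergy
          (by rw [List.length_append, List.length_singleton]; omega) b
  calc ∫ x, ‖wordDeriv w (convect a b) x‖ ^ 2
      ≤ ∫ x, K * Ea * (3 * n * ∑ k : Fin 3, ∑ m : Fin n, c x k m ^ 2) :=
        integral_mono (ci (((ha.convect hb) |> fun h => isSmooth_wordDeriv h w).continuous.norm.pow 2))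
          ((hint_sum.const_mul _).const_mul _) hpt
    _ = K * Ea * (3 * n * ∑ k : Fin 3, ∑ m : Fin n, ∫ x, c x k m ^ 2) := by
        rw [integral_const_mul, integral_const_mul, integral_finsetSum _ fun k _ =>
          integrable_finsetSum _ fun m _ => ci (hcont_c k m)]
        congr 2
        exact Finset.sum_congr rfl fun k _ => integral_finsetSum _ fun m _ => ci (hcont_c k m)
    _ ≤ K * Ea * (3 * n * ∑ _k : Fin 3, ∑ _m : Fin n, Eb) := by
        gcongr with k _ m _
        exact hword k m
    _ = 9 * K * 4 ^ w.length * Ea * Eb := by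
        simp only [Finset.sum_const, Finset.card_univ, Fintype.card_fin, nsmul_eq_mul]
        have h4 : (4 : ℝ) ^ w.length = (n : ℝ) * n := by
          rw [hn, ← mul_pow]; norm_num
        rw [h4]
        push_cast
        ring

/-! ## The pressure-free energy inequality -/

/-- `∫⟪A, B⟫ ≤ ½∫‖A‖² + ½∫‖B‖²` for continuous fields. -/
theorem liftB_integral_inner_le_half {A B : UnitAddTorus (Fin 3) → F'} (hA : Continuous A) (hB : Continuous B) :
    ∫ x, ⟪A x, B x⟫_ℝ ≤ (∫ x, ‖A x‖ ^ 2) / 2 + (∫ x, ‖B x‖ ^ 2) / 2 := by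
  have ci : ∀ {g : UnitAddTorus (Fin 3) → ℝ}, Continuous g → Integrable g volume := fun hg =>
    hg.integrable_of_hasCompactSupport (HasCompactSupport.of_compactSpace _)
  have hpt : ∀ x, ⟪A x, B x⟫_ℝ ≤ ‖A x‖ ^ 2 / 2 + ‖B x‖ ^ 2 / 2 := fun x => by
    have h1 := real_inner_le_norm (A x) (B x)
    nlinarith [two_mul_le_add_sq ‖A x‖ ‖B x‖]
  have iA : Integrable (fun x => ‖A x‖ ^ 2 / 2) volume := ci ((hA.norm.pow 2).div_const 2)
  have iB : Integrable (fun x => ‖B x‖ ^ 2 / 2) volume := ci ((hB.norm.pow 2).div_const 2)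
  calc ∫ x, ⟪A x, B x⟫_ℝ ≤ ∫ x, (‖A x‖ ^ 2 / 2 + ‖B x‖ ^ 2 / 2) :=
        integral_mono (ci (hA.inner hB)) (iA.add iB) hpt
    _ = (∫ x, ‖A x‖ ^ 2) / 2 + (∫ x, ‖B x‖ ^ 2) / 2 := by
        rw [integral_add iA iB, integral_div, integral_div]

/-- **The pressure drops out**: if `A = B − ∇g` on `T³` with `A` smooth and solenoidal and `B`,
`g` smooth, then `∫‖A‖² ≤ ∫‖B‖²` (`∫⟪∇g, A⟫ = 0`, then `∫‖A‖² = ∫⟪A, B⟫ ≤ ½∫‖A‖² + ½∫‖B‖²`). -/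
theorem liftB_integral_norm_sq_le_of_eq_sub_gradient {A B : UnitAddTorus (Fin 3) → EuclideanSpace ℝ (Fin 3)} {g : UnitAddTorus (Fin 3) → ℝ}
    (hA : IsSmooth A) (hB : IsSmooth B) (hg : IsSmooth g) (hdiv : IsDivFree A)
    (h : ∀ x, A x = B x - gradient g x) : ∫ x, ‖A x‖ ^ 2 ≤ ∫ x, ‖B x‖ ^ 2 := by
  have ci : ∀ {f : UnitAddTorus (Fin 3) → ℝ}, Continuous f → Integrable f volume := fun hf =>
    hf.integrable_of_hasCompactSupport (HasCompactSupport.of_compactSpace _)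
  have e1 : ∀ x, ‖A x‖ ^ 2 = ⟪A x, B x⟫_ℝ - ⟪gradient g x, A x⟫_ℝ := by
    intro x
    calc ‖A x‖ ^ 2 = ⟪A x, A x⟫_ℝ := (real_inner_self_eq_norm_sq _).symm
      _ = ⟪A x, B x - gradient g x⟫_ℝ := by rw [← h x]
      _ = ⟪A x, B x⟫_ℝ - ⟪gradient g x, A x⟫_ℝ := by rw [inner_sub_right, real_inner_comm (A x)]
  have e2 : ∫ x, ‖A x‖ ^ 2 = ∫ x, ⟪A x, B x⟫_ℝ := by
    simp_rw [e1]
    rw [integral_sub (ci (hA.continuous.inner hB.continuous))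
        (ci (hg.gradient.continuous.inner hA.continuous)),
      integral_inner_gradient_eq_zero_of_isDivFree hA hg hdiv, sub_zero]
  have h3 := liftB_integral_inner_le_half hA.continuous hB.continuous
  rw [← e2] at h3
  linarith

/-! ## Elementary inequality and the anchor -/

/-- `‖ν • a − b + c‖² ≤ 3 (ν² ‖a‖² + ‖b‖² + ‖c‖²)`. -/
theorem liftB_norm_sq_three_le {G : Type*} [SeminormedAddCommGroup G] [NormedSpace ℝ G]
    (ν : ℝ) (a b c : G) :
    ‖ν • a - b + c‖ ^ 2 ≤ 3 * (ν ^ 2 * ‖a‖ ^ 2 + ‖b‖ ^ 2 + ‖c‖ ^ 2) := by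
  have h1 : ‖ν • a - b + c‖ ≤ |ν| * ‖a‖ + ‖b‖ + ‖c‖ := by
    calc ‖ν • a - b + c‖ ≤ ‖ν • a - b‖ + ‖c‖ := norm_add_le _ _
      _ ≤ ‖ν • a‖ + ‖b‖ + ‖c‖ := by gcongr; exact norm_sub_le _ _
      _ = |ν| * ‖a‖ + ‖b‖ + ‖c‖ := by rw [norm_smul, Real.norm_eq_abs]
  have h0 : 0 ≤ |ν| * ‖a‖ := by positivity
  calc ‖ν • a - b + c‖ ^ 2 ≤ (|ν| * ‖a‖ + ‖b‖ + ‖c‖) ^ 2 := pow_le_pow_left₀ (norm_nonneg _) h1 2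
    _ ≤ 3 * ((|ν| * ‖a‖) ^ 2 + ‖b‖ ^ 2 + ‖c‖ ^ 2) := by
        nlinarith [sq_nonneg (|ν| * ‖a‖ - ‖b‖), sq_nonneg (‖b‖ - ‖c‖), sq_nonneg (|ν| * ‖a‖ - ‖c‖)]
    _ = 3 * (ν ^ 2 * ‖a‖ ^ 2 + ‖b‖ ^ 2 + ‖c‖ ^ 2) := by rw [mul_pow, sq_abs]

/-- Part B, anchor (the registered helper signature): **the pressure drops out** — if `A = B − ∇g`
on `T³` with `A` smooth and solenoidal and `B`, `g` smooth, then `∫‖A‖² ≤ ∫‖B‖²`. -/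
theorem liftB_partB_anchor :
    ∀ (A B : UnitAddTorus (Fin 3) → EuclideanSpace ℝ (Fin 3)) (g : UnitAddTorus (Fin 3) → ℝ),
      IsSmooth A → IsSmooth B → IsSmooth g → IsDivFree A → (∀ x, A x = B x - gradient g x) →
      ∫ x, ‖A x‖ ^ 2 ≤ ∫ x, ‖B x‖ ^ 2 :=
  fun _ _ _ hA hB hg hdiv h => liftB_integral_norm_sq_le_of_eq_sub_gradient hA hB hg hdiv h

end Summit.AnomalousDissipation.AnomalousDissipation.Theorems.ChainRealisation.SeparatrixFluxPinning

end
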